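import Summits.ResolutionOfSingularities.ResolutionOfSingularities.Theorems.EquisingularLiftEquisingularLiftNatSpecimenSmoothHypersurfaces
import Summits.ResolutionOfSingularities.ResolutionOfSingularities.Theorems.EquisingularLiftEquisingularLiftNatSpecimenCiNoseInstances
import Literature.AlgebraicGeometry.Motives.HypersurfaceCharts
import Literature.AlgebraicGeometry.Motives.HypersurfaceChartAlgebra
import Literature.AlgebraicGeometry.Motives.ProjectiveSpaceFieldPointsBijective
import Literature.AlgebraicGeometry.Motives.ProjectiveSpaceDehomogenize
import Literature.AlgebraicGeometry.Resolution.ProjectiveSpaceRegular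
import Literature.AlgebraicGeometry.Resolution.AlterationsProofs
import HarnessLib

/-!
# [OURS · L1 W4.5(b)] HYPERSURFACE CHART RINGS IN EVERY DIMENSION: `ChartRing F i ≅ k[y]/(F|_{xᵢ := 1})`, Noetherian, and
# `V₊(F)` regular ⟺ all chart rings regular (crux `Theses.EquisingularLift.EquisingularLiftNat`, stmt-ResolutionOfSingularities-20038)

NOT a statement of any manuscript; OURS kernel theorem (cell `res-hironaka`, chain w45b; seat res-D-pv-013, own initiative, counted 0). AI-written,
weaker than expert review. No definition, no `sorry`, standard axioms.

Generic (any `n`, any chart `i`) versions of the `ℙ³` plumbing used by every EL♮ specimen so far (`FermatCone.exists_chartQuotEquiv`, p517740,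
is the `Fin 4` case), meant as the building blocks of an all-`n` cone / cylinder specimen:

* **`HypersurfaceSpecimen.exists_chartQuotEquiv`** — for a homogeneous `F ∈ k[x₀,…,x_{n+1}]` and `f = F(xᵢ := 1)` with `(f)` radical, a ring
  isomorphism `ChartRing F i ≃+* k[y₀,…,yₙ]/(f)` taking the tautological coordinate `x_{i.succAbove j}/xᵢ` to `ȳⱼ`;
* `HypersurfaceSpecimen.isNoetherianRing_chartRing` — `ChartRing F i` is Noetherian (a quotient of `k[x]_{(xᵢ)} ≅ k[y]`);
* `HypersurfaceSpecimen.isRegularRing_chartRing_of_isRegular` / `isRegular_hypersurface_of_forall_isRegularRing_chartRing` /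
  **`isRegular_hypersurface_iff_forall_isRegularRing_chartRing`** — `V₊(F)` is a regular scheme iff all `n + 2` chart rings are regular rings
  (the charts `Spec (ChartRing F i) → V₊(F)` are open immersions covering `V₊(F)`; Stacks 02IS);
* **`HypersurfaceSpecimen.isRegularRing_chartRing_of_isNonsingularForm`** — a nonsingular form has regular chart rings, every `i`, every `n`.

References: Hartshorne 1977 I Thm. 3.4, II Prop. 5.9, II Example 3.2.6; The Stacks Project 02IS.
-/

set_option linter.dupNamespace false -- mandated namespace `Summit.<Summit>.<Problem>` of this single-conjunct summit

noncomputable section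

open CategoryTheory AlgebraicGeometry MvPolynomial HomogeneousLocalization
open Literature.AlgebraicGeometry.Resolution
open Literature.AlgebraicGeometry.Motives Literature.AlgebraicGeometry.Motives.SmoothHypersurface
open Literature.AlgebraicGeometry.Motives.ProjectiveSpace

namespace Summit.ResolutionOfSingularities.ResolutionOfSingularities.Cruxes.EquisingularLiftNat.Sections

namespace HypersurfaceSpecimen

variable (k : Type) [Field k] {n : ℕ}

attribute [local instance] MvPolynomial.gradedAlgebra ProjBaseChange.algebraBase

/-! ## `ChartRing F i ≅ k[y]/(F(xᵢ := 1))` -/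

variable {k} in
/-- **`ChartRing F i ≃+* k[y₀, …, yₙ]/(f)`** for a homogeneous `F ∈ k[x₀,…,x_{n+1}]`, `f = F(xᵢ := 1)` with `(f)` radical, taking the
tautological coordinate `x_{i.succAbove j}/xᵢ` to `ȳ_j` (dehomogenisation, Hartshorne I Thm 3.4, on the reduced induced structure II Example 3.2.6) —
any `n` (the `Fin 4` case is `FermatCone.exists_chartQuotEquiv`). [folklore] -/
theorem exists_chartQuotEquiv (F : MvPolynomial (Fin (n + 2)) k) {e : ℕ} (hF : F.IsHomogeneous e) (c : Fin (n + 2))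
    (f : MvPolynomial (Fin (n + 1)) k) (hf : dehomogenize k c F = f) (hrad : (Ideal.span {f}).radical = Ideal.span {f}) :
    ∃ θ : ChartRing F c hF ≃+* (MvPolynomial (Fin (n + 1)) k ⧸ Ideal.span {f}),
      ∀ j : Fin (n + 1), θ (tautVec F c hF (c.succAbove j)) = Ideal.Quotient.mk _ (X j) := by
  have h1 : chartAlgEquiv k c (chartEqn F c hF) = dehomogenize k c F := by
    rw [chartEqn, isLocalizationElem_X]
    exact (chartAlgEquiv k c).apply_symm_apply _
  have hmapspan : (Ideal.span {chartEqn F c hF}).map (chartAlgEquiv k c).toRingEquiv.toRingHom = Ideal.span {f} := by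
    rw [Ideal.map_span, Set.image_singleton]
    exact congrArg (fun q => Ideal.span {q}) (h1.trans hf)
  have hideal : chartIdeal F c hF = Ideal.span {chartEqn F c hF} := by
    have hspan : Ideal.span {chartEqn F c hF} = (Ideal.span {f}).comap (chartAlgEquiv k c).toRingEquiv.toRingHom := by
      rw [← hmapspan]
      exact (Ideal.comap_map_of_bijective (chartAlgEquiv k c).toRingEquiv.toRingHom
        (chartAlgEquiv k c).toRingEquiv.bijective).symm
    rw [chartIdeal, hspan, ← Ideal.comap_radical, hrad]
  have hmap : Ideal.span {f} = (chartIdeal F c hF).map (chartAlgEquiv k c).toRingEquiv.toRingHom := by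
    rw [hideal, hmapspan]
  refine ⟨Ideal.quotientEquiv _ _ (chartAlgEquiv k c).toRingEquiv hmap, fun j => ?_⟩
  have hq : Ideal.quotientEquiv _ _ (chartAlgEquiv k c).toRingEquiv hmap (toChartRing F c hF (coord c (c.succAbove j))) =
      Ideal.Quotient.mk _ (chartAlgEquiv k c (coord c (c.succAbove j))) :=
    Ideal.quotientEquiv_mk _ _ _ _ _
  rw [tautVec_apply]
  refine hq.trans ?_
  rw [coord_succAbove, ← chartAlgEquiv_symm_X k c j, AlgEquiv.apply_symm_apply]

/-- **`ChartRing F i` is Noetherian** (a quotient of `k[x]_{(xᵢ)} ≅ k[y₀,…,yₙ]`). [folklore] -/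
theorem isNoetherianRing_chartRing (F : MvPolynomial (Fin (n + 2)) k) {e : ℕ} (hF : F.IsHomogeneous e) (c : Fin (n + 2)) :
    IsNoetherianRing (ChartRing F c hF) := by
  haveI : IsNoetherianRing (Away (homogeneousSubmodule (Fin (n + 2)) k) (X c)) :=
    isNoetherianRing_of_ringEquiv (MvPolynomial (Fin (n + 1)) k) (chartAlgEquiv k c).symm.toRingEquiv
  exact inferInstanceAs (IsNoetherianRing (Away (homogeneousSubmodule (Fin (n + 2)) k) (X c) ⧸ chartIdeal F c hF))

/-! ## `V₊(F)` regular ⟺ all chart rings regular -/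

/-- **Regular hypersurface ⇒ regular chart rings**: `Spec (ChartRing F i) → V₊(F)` is an open immersion (Stacks 02IS). [folklore] -/
theorem isRegularRing_chartRing_of_isRegular (F : MvPolynomial (Fin (n + 2)) k) {e : ℕ} (hF : F.IsHomogeneous e) (he : 0 < e)
    (hreg : Scheme.IsRegular (hypersurface F).left) (c : Fin (n + 2)) : IsRegularRing (ChartRing F c hF) := by
  have h1 : Scheme.IsRegular (Spec (CommRingCat.of (ChartRing F c hF))) :=
    @Scheme.IsRegular.of_isOpenImmersion _ _ (chart F c hF he).left (isOpenImmersion_chart_left F c hF he) hreg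
  exact (@Scheme.isRegular_Spec_iff (CommRingCat.of (ChartRing F c hF)) (isNoetherianRing_chartRing k F hF c)).mp h1

/-- **Regular chart rings ⇒ regular hypersurface**: the charts `Spec (ChartRing F i)`, `i = 0,…,n+1`, cover `V₊(F)`. [folklore] -/
theorem isRegular_hypersurface_of_forall_isRegularRing_chartRing (F : MvPolynomial (Fin (n + 2)) k) {e : ℕ} (hF : F.IsHomogeneous e)
    (he : 0 < e) (hreg : ∀ c : Fin (n + 2), IsRegularRing (ChartRing F c hF)) : Scheme.IsRegular (hypersurface F).left := by
  intro x
  obtain ⟨c, hc⟩ := exists_mem_coordChartOpen ((hypersurfaceι F).left x)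
  have hx : x ∈ Set.range (chart F c hF he).left := by
    rw [range_chart_left]
    exact hc
  obtain ⟨y, rfl⟩ := hx
  haveI := hreg c
  haveI := isOpenImmersion_chart_left F c hF he
  have hy : IsRegularLocalRing ((specOver k (ChartRing F c hF)).left.presheaf.stalk y) :=
    Scheme.isRegular_Spec (CommRingCat.of (ChartRing F c hF)) y
  exact IsRegularLocalRing.of_ringEquiv (asIso ((chart F c hF he).left.stalkMap y)).commRingCatIsoToRingEquiv.symm

/-- **`V₊(F)` IS A REGULAR SCHEME IFF ALL ITS CHART RINGS ARE REGULAR RINGS** (any `n`, any homogeneous `F` of positive degree).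
[cite: StacksProject, Tag 02IS] -/
theorem isRegular_hypersurface_iff_forall_isRegularRing_chartRing (F : MvPolynomial (Fin (n + 2)) k) {e : ℕ} (hF : F.IsHomogeneous e)
    (he : 0 < e) : Scheme.IsRegular (hypersurface F).left ↔ ∀ c : Fin (n + 2), IsRegularRing (ChartRing F c hF) :=
  ⟨fun h c => isRegularRing_chartRing_of_isRegular k F hF he h c, isRegular_hypersurface_of_forall_isRegularRing_chartRing k F hF he⟩

/-- **A nonsingular form has regular chart rings** — every chart, every dimension (tree smoothness of `V₊(F)` ⇒ `Scheme.IsRegular` ⇒ charts).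
[cite: Hartshorne1977, I Ex. 5.8] -/
theorem isRegularRing_chartRing_of_isNonsingularForm (F : MvPolynomial (Fin (n + 2)) k) {e : ℕ} (hF : F.IsHomogeneous e)
    (hJ : IsNonsingularForm k F) (he : 0 < e) (c : Fin (n + 2)) : IsRegularRing (ChartRing F c hF) :=
  isRegularRing_chartRing_of_isRegular k F hF he (isRegular_hypersurface_of_isNonsingularForm k F hF hJ he) c

end HypersurfaceSpecimen

end Summit.ResolutionOfSingularities.ResolutionOfSingularities.Cruxes.EquisingularLiftNat.Sections

end
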